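import Summits.QuantumFields.YangMills.Theorems.BalabanUVNodesK0CompCofinalRadiiOfFixedRadiusGuarded

/-!
# K0⁷ — THE BOX EDITION: DEF-1's door (α_cof) (a |β|-box at SOME radius below every ceiling) from NODE O's BOXES AT ONE FIXED RADIUS `ā` along cofinal (2.9)-thresholds,
# with N07's slots asked INSIDE A LEVEL GUARD only and `hT1` there supplied by the (8)-text + EU-text — the by-name target for a box producer (lens-1 «cauchy-analytic», GLUE-ρ2's
# `hbox` currency of ✓p793022) that reaches the wall at ONE radius; companion of the comparability edition `…K0CompCofinalRadiiOfFixedRadiusGuarded`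

Cell `pub-ymgap`, width seat `pub-ymgap-dag-n07-w3` (g21; N07 [B11] ∕ K0⁷ junction).  `--kind proof --supports stmt-QuantumFields-20541 --as helper`, COUNT-NEUTRAL.  NEW leaf; theorems
only — 0 `def`, 0 `sorry`, 0 `instance`, 0 `notation`.  Imports ONLY this seat's `…K0CompCofinalRadiiOfFixedRadiusGuarded` (the guarded β-identity `betaZB_eq_down_of_slots_guarded` and
`hT1_guarded_of_texts`).  [I] = [Balaban1987RG1]; [15] = [Balaban1985Variational]; [III] = [Balaban1988Convergent]; [B7] = [Balaban1985Averaging].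

CONTENT.  ★★ `k0BoxCofinalRadii_clause_of_boxAtFixedRadius_guarded` — ✓p795400's `k0BoxCofinalRadii_clause_of_boxAtFixedRadius` (file 4's producer rows (W₁) `hbox` VERBATIM: for every
`ε₂₉ ∈ (0, εmax]` a box `−β′ ≤ β₁₃(F; ā, ε₂₉) ≤ β′` on some `]0, γ₀]`; the continuity rows; the nine door-level numerics) with the four N07 slots asked only at guarded members and the continuity rows
only at guarded steps (guard antitone in the level, eventually true in `K`);  ★★★ `k0BoxCofinalRadii_clause_of_texts_of_boxAtFixedRadius` — the same at the guard `k + max c₀ c₁ ≤ F.m + K` with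
`hT1` DISCHARGED by the two [15] texts (`hT1_guarded_of_texts`; `B := B₃ ≥ 7`, ceilings `(a₀, min a₁ (a₀∕B₃))`).  K0⁷ BY NAME: `K0V23Stub3DoorSuppliers.record13SepCoPHInhabited_of_k0BoxCofinalRadii
(fun F => k0BoxCofinalRadii_clause_of_texts_of_boxAtFixedRadius F …)` (Theses cone; one line; not typed here).
A6: `textsDoorNumerics_inhabited` — the door-level letters (ā, δ₁₁, α, εmax) of BOTH texts editions (this file's and the comparability edition's) are a jointly inhabited range for every
`a₀, a₁, B₃ > 0`, `B_L ≥ 0`, `t_L, r_L > 0` (file 2's `openNumerics_inhabited` + file 4's `cofinalNumerics_inhabited` + two rider ceilings on `ā`).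

HONEST FRAMING (binding).  By-name composition + real arithmetic; NO β estimate; nothing of Bałaban's asserted or discharged.  DISPLAYED and inhabited nowhere: the one-radius box (NODE O's
wall: [I] Thm 3 β-clause p. 264, proof unpublished [Balaban1989LargeFieldII] p. 355), the continuity rows (hT), the EU-text ([15] Thm 1 E∕U, N12's sentence), `hUk` ∕ `h11` (PLAQUETTE-class
rows — D-defB-1 stands), `hLip` ([15] Prop. 9 species).  Stub 2′ OPEN; K0⁷ stmt-QuantumFields-20541 NOT closed; N07 NOT discharged; COUNT 8∕28 · K 1∕4 UNMOVED; R4 = the CONDITIONAL finite-𝕋⁴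
rung `BalabanLadder.UV` at fixed `ε = L^(−K)` only — NOT continuum ∕ ℝ⁴ ∕ OS; the Yang–Mills mass gap (Clay) is NOT proved by any of this.  Standard axioms only.
-/

noncomputable section

open MeasureTheory Set Filter Topology
open scoped Matrix.Norms.L2Operator

namespace Summit.QuantumFields.YangMills.BalabanUVNodes.K0BoxCofinalRadiiOfFixedRadiusGuarded

open Literature.MathematicalPhysics.QuantumFieldTheory.Balaban1983to89
open Literature.MathematicalPhysics.QuantumFieldTheory.Balaban1983to89.Node00
open Literature.MathematicalPhysics.QuantumFieldTheory.Balaban1983to89.T4Continuum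
open Literature.MathematicalPhysics.QuantumFieldTheory.Balaban1983to89.FlowStep
open Literature.MathematicalPhysics.QuantumFieldTheory.Balaban1983to89.B15DeterminingSets
open Literature.MathematicalPhysics.QuantumFieldTheory.Balaban1983to89.ExpMeanLog (deltaSU deltaSU_pos)
open Literature.MathematicalPhysics.QuantumFieldTheory.Balaban1983to89.B12GaugeOrbits021 (OrbitRel)
open Literature.MathematicalPhysics.QuantumFieldTheory.Balaban1983to89.B11Thm1ExistsUniqueCoP7MG (VariationalThm1EUSepCoP7MG)
open B12Eq019ActionBody (integrand)
open Summit.QuantumFields.YangMills.BalabanUVNodes.K0CompCofinalRadiiOfFixedRadiusGuarded (betaZB_eq_down_of_slots_guarded hT1_guarded_of_texts)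
open Summit.QuantumFields.YangMills.BalabanUVNodes.K0TwoPrimeOfMembershipDomain (openNumerics_inhabited)
open Summit.QuantumFields.YangMills.BalabanUVNodes.K0TwoPrimeOfCofinalBoxes (cofinalNumerics_inhabited)

variable (F : T4Family)

/-- ★★ **DOOR (α_cof)'s `F`-CLAUSE FROM BOXES AT ONE FIXED RADIUS, SLOTS INSIDE A LEVEL GUARD** — ✓p795400's `k0BoxCofinalRadii_clause_of_boxAtFixedRadius` with the four N07 slots asked only
at guarded members `(K, k)` (`G K k`) and the continuity rows only at guarded steps (`G K (k+1)`), `G` antitone in the level and eventually true in `K`.  Per ceiling `a`: `a₀ := min a ā`,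
`ε₂₉ := min εmax (a₀∕c)`, `ρ := c·ε₂₉`, `c := 80B_L L⁴ + 1`; the box at `ā` transported along `betaZB_eq_down_of_slots_guarded`.  CONDITIONAL on every displayed row; NO β estimate; nothing of
Bałaban's asserted. [cite: Balaban1987RG1, Thm 1 p.259, Thm 3 p.264, (1.20)–(1.22) p.264, (1.1)–(1.2) p.260, (2.9) p.266 and p.267; Balaban1985Variational, Thm 1 (6),(8)–(10) p.279, Prop. 9 p.309; Balaban1985Averaging, Prop. 2 (53) p.26 (bookkeeping)] -/
theorem k0BoxCofinalRadii_clause_of_boxAtFixedRadius_guarded (ā δ₁₁ α₀ α₁ B α tL rL BL εmax : ℝ) (hā : 0 < ā) (hāα₀ : ā < α₀) (hB : 0 ≤ B) (hBL : 0 ≤ BL)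
    (hδ₁₁ : 0 < δ₁₁) (hδα₁ : δ₁₁ ≤ α₁) (hBδ : B * δ₁₁ ≤ ā)
    (hāα : ā < α) (hα3 : 143 * 256 * α ≤ 1 / 3) (hα2 : 2 * α ≤ 2 * deltaSU (Fin 2) / (8 * (F.L : ℝ)) ^ 2)
    (hα24 : 9 * (F.L : ℝ) ^ 2 * (2 * α) ≤ 1 / 24) (hαL : 157 * (9 * (F.L : ℝ) ^ 2 * (2 * α)) < ((F.L : ℝ) ^ 3)⁻¹)
    (hεmax : 0 < εmax)
    (hε53a : 143 * 256 * ((80 * BL * (F.L : ℝ) ^ 4 + 1) * εmax) ≤ 1 / 3)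
    (hε53b : 2 * ((80 * BL * (F.L : ℝ) ^ 4 + 1) * εmax) ≤ 2 * deltaSU (Fin 2) / (8 * (F.L : ℝ)) ^ 2)
    (hεδ : 2 * ((80 * BL * (F.L : ℝ) ^ 4 + 1) * εmax) ≤ δ₁₁) (hεα₁ : 2 * ((80 * BL * (F.L : ℝ) ^ 4 + 1) * εmax) ≤ α₁)
    (hεB : 2 * B * ((80 * BL * (F.L : ℝ) ^ 4 + 1) * εmax) ≤ ā)
    (hεn1 : 1640 * (12 * (F.L : ℝ) * εmax + 18 * ā) * (F.L : ℝ) ^ 6 ≤ 1) (hεn2 : 13 * (12 * (F.L : ℝ) * εmax + 18 * ā) * (F.L : ℝ) ^ 3 < deltaSU (Fin 2))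
    (hεtL : 60 * (F.L : ℝ) ^ 4 * εmax ≤ tL) (hεrL : (80 * BL * (F.L : ℝ) ^ 4 + 1) * εmax / (F.L : ℝ) ^ 2 ≤ rL)
    (G : ℕ → ℕ → Prop) (hmono : ∀ K k, G K (k + 1) → G K k) (hev : ∀ k, ∀ᶠ K in atTop, G K k)
    (hT1 : ∀ (K k : ℕ), G K k → ∀ ε₁ : ℝ, 0 < ε₁ → ε₁ ≤ α₁ → ∀ V : GaugeField (F.P K) k (Node00.SU 2), PlaqSmall ε₁ V →
      (∃ U : GaugeField (F.P K) 0 (Node00.SU 2), IsBackground (avOfRecord F 2 K) {U | InUkClassB11 F 2 K k (B * ε₁) U} k V U) ∧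
      (∀ ε₀ : ℝ, B * ε₁ ≤ ε₀ → ε₀ ≤ α₀ → ∀ U U' : GaugeField (F.P K) 0 (Node00.SU 2),
          IsBackground (avOfRecord F 2 K) {U | InUkClassB11 F 2 K k (B * ε₁) U} k V U →
          IsBackground (avOfRecord F 2 K) {U | InUkClassB11 F 2 K k ε₀ U} k V U' → InUkClassB11 F 2 K k ε₀ U ∧ OrbitRel k U U'))
    (hUk : ∀ (K k : ℕ), G K k → ∀ ε : ℝ, ā ≤ ε → ε ≤ α₀ → ∀ (V : GaugeField (F.P K) k (Node00.SU 2)) (δ : ℝ), 0 < δ → δ ≤ α₁ → B * δ ≤ ε → PlaqSmall δ V →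
      UkExists F 2 K k ε V ∧ InUkClassB11 F 2 K k ε (Uk F 2 K k ε V))
    (h11 : ∀ (K k : ℕ), G K k → ∀ ε : ℝ, ā ≤ ε → ε ≤ α₀ → ∀ V : GaugeField (F.P K) k (Node00.SU 2), PlaqSmall δ₁₁ V → UkExists F 2 K k ε V ∧ UniqueUkOrbit F 2 K k ε V)
    (hLip : ∀ (K k : ℕ), G K k → ∀ (V V' : GaugeField (F.P K) k (Node00.SU 2)) (t r : ℝ), 0 ≤ t → t ≤ tL → 0 < r → r ≤ rL →
      (∀ b, dist1 ((V' b)⁻¹ * V b) ≤ t) →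
      (UkExists F 2 K k ā V' ∧ ∀ U₁, IsBackground (avOfRecord F 2 K) (bgReg F 2 K k ā) k V' U₁ → U₁ ∈ bgReg F 2 K k r) →
      (UkExists F 2 K k ā V ∧ ∀ U₁, IsBackground (avOfRecord F 2 K) (bgReg F 2 K k ā) k V U₁ → U₁ ∈ bgReg F 2 K k (r + BL * t)))
    (hbox : ∀ ε₂₉ : ℝ, 0 < ε₂₉ → ε₂₉ ≤ εmax → ∃ γ₀ β' : ℝ, 0 < γ₀ ∧
      BetaLowerH (-β') γ₀ (betaOfRecord₁₃ F 2 (theta13OfThm1CCMWZB F 2 0 (1 / 2) ā 0 ε₂₉ 0 0 ā 0 (fun _ _ => 0) (fun _ _ => 0))) ∧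
      BetaUpperH β' γ₀ (betaOfRecord₁₃ F 2 (theta13OfThm1CCMWZB F 2 0 (1 / 2) ā 0 ε₂₉ 0 0 ā 0 (fun _ _ => 0) (fun _ _ => 0))))
    (hT : ∀ ε₂₉ : ℝ, 0 < ε₂₉ → ε₂₉ ≤ εmax → ∀ K (g : ℕ → ℝ) k, k < K → G K (k + 1) →
      {V : GaugeField (F.P K) (k + 1) (Node00.SU 2) | PlaqSmall δ₁₁ V} ⊆ regSetOfRecord F 2 K k
        (integrand (chiFixed29 F 2 (numerics7OfThm1CCM F.L 0 0 0 0 ā 0) ε₂₉ K g k) (gfOfRecord F 2 K k) (g k)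
          (effActionHT F 2 (TcanOfRecord F 2) (chiFixed29 F 2 (numerics7OfThm1CCM F.L 0 0 0 0 ā 0) ε₂₉) K g k))) :
    ∀ a : ℝ, 0 < a → ∃ a₀ : ℝ, 0 < a₀ ∧ a₀ ≤ a ∧
      ∃ (γ₀ ε₂₉ β' : ℝ) (j : ℕ) (ε₀ B₃ B₃' a₁ : ℝ) (Efl logz : B12.RunParams → ℕ → ℝ), 0 < γ₀ ∧ 0 < ε₂₉ ∧
        BetaLowerH (-β') γ₀ (betaOfRecord₁₃ F 2 (theta13OfThm1CCMWZB F 2 j (1 / 2) a₀ ε₀ ε₂₉ B₃ B₃' a₀ a₁ Efl logz)) ∧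
        BetaUpperH β' γ₀ (betaOfRecord₁₃ F 2 (theta13OfThm1CCMWZB F 2 j (1 / 2) a₀ ε₀ ε₂₉ B₃ B₃' a₀ a₁ Efl logz)) := by
  intro a ha
  have hL11 : (11 : ℝ) < (F.L : ℝ) := by exact_mod_cast F.hL11
  have hL0 : (0 : ℝ) < (F.L : ℝ) := by linarith
  have hL4 : (4 : ℝ) ≤ (F.L : ℝ) ^ 2 := by nlinarith
  obtain ⟨c, hc⟩ : ∃ c : ℝ, c = 80 * BL * (F.L : ℝ) ^ 4 + 1 := ⟨_, rfl⟩
  have hcpos : 0 < c := by rw [hc]; positivity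
  obtain ⟨a₀, ha₀⟩ : ∃ a₀ : ℝ, a₀ = min a ā := ⟨_, rfl⟩
  have ha₀pos : 0 < a₀ := by rw [ha₀]; exact lt_min ha hā
  have ha₀a : a₀ ≤ a := by rw [ha₀]; exact min_le_left _ _
  have ha₀ā : a₀ ≤ ā := by rw [ha₀]; exact min_le_right _ _
  obtain ⟨ε, hε⟩ : ∃ ε : ℝ, ε = min εmax (a₀ / c) := ⟨_, rfl⟩
  have hεpos : 0 < ε := by rw [hε]; exact lt_min hεmax (div_pos ha₀pos hcpos)
  have hεle : ε ≤ εmax := by rw [hε]; exact min_le_left _ _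
  have hεa₀ : ε ≤ a₀ / c := by rw [hε]; exact min_le_right _ _
  have hρle : c * ε ≤ c * εmax := mul_le_mul_of_nonneg_left hεle hcpos.le
  have hcε : c * εmax = (80 * BL * (F.L : ℝ) ^ 4 + 1) * εmax := by rw [hc]
  have hρa₀ : c * ε ≤ a₀ := by
    calc c * ε ≤ c * (a₀ / c) := mul_le_mul_of_nonneg_left hεa₀ hcpos.le
      _ = a₀ := mul_div_cancel₀ a₀ hcpos.ne'
  have h53a : 143 * 256 * (c * ε) ≤ 1 / 3 :=
    calc 143 * 256 * (c * ε) ≤ 143 * 256 * (c * εmax) := by gcongr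
      _ ≤ 1 / 3 := by rw [hcε]; exact hε53a
  have h53b : 2 * (c * ε) ≤ 2 * deltaSU (Fin 2) / (8 * (F.L : ℝ)) ^ 2 :=
    calc 2 * (c * ε) ≤ 2 * (c * εmax) := by gcongr
      _ ≤ 2 * deltaSU (Fin 2) / (8 * (F.L : ℝ)) ^ 2 := by rw [hcε]; exact hε53b
  have hδ : 2 * (c * ε) ≤ δ₁₁ :=
    calc 2 * (c * ε) ≤ 2 * (c * εmax) := by gcongr
      _ ≤ δ₁₁ := by rw [hcε]; exact hεδ
  have hα₁ : 2 * (c * ε) ≤ α₁ :=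
    calc 2 * (c * ε) ≤ 2 * (c * εmax) := by gcongr
      _ ≤ α₁ := by rw [hcε]; exact hεα₁
  have hBρ : 2 * B * (c * ε) ≤ ā :=
    calc 2 * B * (c * ε) ≤ 2 * B * (c * εmax) := mul_le_mul_of_nonneg_left hρle (by positivity)
      _ ≤ ā := by rw [hcε]; exact hεB
  have hn1 : 1640 * (12 * (F.L : ℝ) * ε + 18 * ā) * (F.L : ℝ) ^ 6 ≤ 1 := by
    have h : 1640 * (12 * (F.L : ℝ) * ε + 18 * ā) * (F.L : ℝ) ^ 6 ≤ 1640 * (12 * (F.L : ℝ) * εmax + 18 * ā) * (F.L : ℝ) ^ 6 := by gcongr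
    exact h.trans hεn1
  have hn2 : 13 * (12 * (F.L : ℝ) * ε + 18 * ā) * (F.L : ℝ) ^ 3 < deltaSU (Fin 2) := by
    have h : 13 * (12 * (F.L : ℝ) * ε + 18 * ā) * (F.L : ℝ) ^ 3 ≤ 13 * (12 * (F.L : ℝ) * εmax + 18 * ā) * (F.L : ℝ) ^ 3 := by gcongr
    exact h.trans_lt hεn2
  have htL : 60 * (F.L : ℝ) ^ 4 * ε ≤ tL :=
    calc 60 * (F.L : ℝ) ^ 4 * ε ≤ 60 * (F.L : ℝ) ^ 4 * εmax := by gcongr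
      _ ≤ tL := hεtL
  have hrL : c * ε / (F.L : ℝ) ^ 2 ≤ rL :=
    calc c * ε / (F.L : ℝ) ^ 2 ≤ c * εmax / (F.L : ℝ) ^ 2 := by gcongr
      _ ≤ rL := by rw [hcε]; exact hεrL
  have hLρ : c * ε / (F.L : ℝ) ^ 2 + BL * (60 * (F.L : ℝ) ^ 4 * ε) ≤ c * ε := by
    have h1 : c * ε / (F.L : ℝ) ^ 2 ≤ c * ε / 4 := div_le_div_of_nonneg_left (by positivity) (by norm_num) hL4
    have h2 : BL * (60 * (F.L : ℝ) ^ 4 * ε) = 60 * (BL * (F.L : ℝ) ^ 4 * ε) := by ring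
    have h3 : c * ε = 80 * (BL * (F.L : ℝ) ^ 4 * ε) + ε := by rw [hc]; ring
    have h4 : 0 ≤ BL * (F.L : ℝ) ^ 4 * ε := by positivity
    rw [h2]
    linarith
  have heq := betaZB_eq_down_of_slots_guarded F ā δ₁₁ α₀ α₁ B α tL rL BL hā hāα₀ hB hδ₁₁ hδα₁ hBδ hāα hα3 hα2 hα24 hαL G hmono hev hT1 hUk h11 hLip
    ha₀ā hρa₀ (mul_pos hcpos hεpos) h53a h53b hδ hα₁ hBρ hεpos.le hn1 hn2 htL hrL hLρ (hT ε hεpos hεle)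
  obtain ⟨γ₀, β', hγ₀, hlo, hup⟩ := hbox ε hεpos hεle
  refine ⟨a₀, ha₀pos, ha₀a, γ₀, ε, β', 0, 0, 0, 0, 0, fun _ _ => 0, fun _ _ => 0, hγ₀, hεpos, ?_, ?_⟩
  · rw [← heq]; exact hlo
  · rw [← heq]; exact hup

/-- ★★★ **DOOR (α_cof)'s `F`-CLAUSE FROM THE TWO [15] TEXTS + `hUk ∕ h11 ∕ hLip` INSIDE THE GUARD + NODE O's BOXES AT ONE RADIUS** — the previous theorem at the guard
`G K k := k + max c₀ c₁ ≤ F.m + K`, constant `B := B₃ ≥ 7`, ceilings `α₀ := a₀`, `α₁ := min a₁ (a₀∕B₃)`, with `hT1` DISCHARGED by `hT1_guarded_of_texts` (the (8)-text — dag-n07-e's theorem at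
`N = 2`, the S1c witness's letters — and N12's EU-text at the same guard letters).  CONDITIONAL on every displayed row; NO β estimate; nothing of Bałaban's asserted; K0⁷ NOT closed.
[cite: Balaban1985Variational, Thm 1 (6),(8)–(10) pp.278–279, Prop. 8 p.304, Prop. 9 p.309; Balaban1987RG1, Thm 1 p.259, Thm 3 p.264, §1 p.264, (1.20)–(1.22) p.264, (1.1)–(1.2) p.260, (2.9) p.266 and p.267; Balaban1988Convergent, (2.12) p.256; Balaban1985Averaging, Prop. 2 (53) p.26 (bookkeeping)] -/
theorem k0BoxCofinalRadii_clause_of_texts_of_boxAtFixedRadius {c c₀ c₁ : ℕ} {B₃ a₀ a₁ : ℝ} (hB₃ : 7 ≤ B₃)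
    (h15 : VariationalThm1RegSepCoP7MGB F 2
      (fun ν M g K k _s => c ≤ ν.M₁ ∧ k + c₀ ≤ F.m + K ∧ F.L ^ c₁ ∣ M ∧
        ∀ i, 1 ≤ i → i ≤ k → dCubeSide (F.P K).L M (RkOfRecord (F.P K).L ν.r (g i)) i ∣ (F.P K).sitesPerDir 0) (lamDatum F) (dataSmall7LamTopOf F 2) B₃ a₀ a₁)
    (hEU : VariationalThm1EUSepCoP7MG F 2
      (fun ν M g K k _s => c ≤ ν.M₁ ∧ k + c₀ ≤ F.m + K ∧ F.L ^ c₁ ∣ M ∧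
        ∀ i, 1 ≤ i → i ≤ k → dCubeSide (F.P K).L M (RkOfRecord (F.P K).L ν.r (g i)) i ∣ (F.P K).sitesPerDir 0) B₃ a₀ a₁)
    (ā δ₁₁ α tL rL BL εmax : ℝ) (hā : 0 < ā) (hāα₀ : ā < a₀) (hBL : 0 ≤ BL)
    (hδ₁₁ : 0 < δ₁₁) (hδα₁ : δ₁₁ ≤ min a₁ (a₀ / B₃)) (hBδ : B₃ * δ₁₁ ≤ ā)
    (hāα : ā < α) (hα3 : 143 * 256 * α ≤ 1 / 3) (hα2 : 2 * α ≤ 2 * deltaSU (Fin 2) / (8 * (F.L : ℝ)) ^ 2)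
    (hα24 : 9 * (F.L : ℝ) ^ 2 * (2 * α) ≤ 1 / 24) (hαL : 157 * (9 * (F.L : ℝ) ^ 2 * (2 * α)) < ((F.L : ℝ) ^ 3)⁻¹)
    (hεmax : 0 < εmax)
    (hε53a : 143 * 256 * ((80 * BL * (F.L : ℝ) ^ 4 + 1) * εmax) ≤ 1 / 3)
    (hε53b : 2 * ((80 * BL * (F.L : ℝ) ^ 4 + 1) * εmax) ≤ 2 * deltaSU (Fin 2) / (8 * (F.L : ℝ)) ^ 2)
    (hεδ : 2 * ((80 * BL * (F.L : ℝ) ^ 4 + 1) * εmax) ≤ δ₁₁) (hεα₁ : 2 * ((80 * BL * (F.L : ℝ) ^ 4 + 1) * εmax) ≤ min a₁ (a₀ / B₃))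
    (hεB : 2 * B₃ * ((80 * BL * (F.L : ℝ) ^ 4 + 1) * εmax) ≤ ā)
    (hεn1 : 1640 * (12 * (F.L : ℝ) * εmax + 18 * ā) * (F.L : ℝ) ^ 6 ≤ 1) (hεn2 : 13 * (12 * (F.L : ℝ) * εmax + 18 * ā) * (F.L : ℝ) ^ 3 < deltaSU (Fin 2))
    (hεtL : 60 * (F.L : ℝ) ^ 4 * εmax ≤ tL) (hεrL : (80 * BL * (F.L : ℝ) ^ 4 + 1) * εmax / (F.L : ℝ) ^ 2 ≤ rL)
    (hUk : ∀ (K k : ℕ), k + max c₀ c₁ ≤ F.m + K → ∀ ε : ℝ, ā ≤ ε → ε ≤ a₀ → ∀ (V : GaugeField (F.P K) k (Node00.SU 2)) (δ : ℝ), 0 < δ → δ ≤ min a₁ (a₀ / B₃) → B₃ * δ ≤ ε →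
      PlaqSmall δ V → UkExists F 2 K k ε V ∧ InUkClassB11 F 2 K k ε (Uk F 2 K k ε V))
    (h11 : ∀ (K k : ℕ), k + max c₀ c₁ ≤ F.m + K → ∀ ε : ℝ, ā ≤ ε → ε ≤ a₀ → ∀ V : GaugeField (F.P K) k (Node00.SU 2), PlaqSmall δ₁₁ V →
      UkExists F 2 K k ε V ∧ UniqueUkOrbit F 2 K k ε V)
    (hLip : ∀ (K k : ℕ), k + max c₀ c₁ ≤ F.m + K → ∀ (V V' : GaugeField (F.P K) k (Node00.SU 2)) (t r : ℝ), 0 ≤ t → t ≤ tL → 0 < r → r ≤ rL →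
      (∀ b, dist1 ((V' b)⁻¹ * V b) ≤ t) →
      (UkExists F 2 K k ā V' ∧ ∀ U₁, IsBackground (avOfRecord F 2 K) (bgReg F 2 K k ā) k V' U₁ → U₁ ∈ bgReg F 2 K k r) →
      (UkExists F 2 K k ā V ∧ ∀ U₁, IsBackground (avOfRecord F 2 K) (bgReg F 2 K k ā) k V U₁ → U₁ ∈ bgReg F 2 K k (r + BL * t)))
    (hbox : ∀ ε₂₉ : ℝ, 0 < ε₂₉ → ε₂₉ ≤ εmax → ∃ γ₀ β' : ℝ, 0 < γ₀ ∧
      BetaLowerH (-β') γ₀ (betaOfRecord₁₃ F 2 (theta13OfThm1CCMWZB F 2 0 (1 / 2) ā 0 ε₂₉ 0 0 ā 0 (fun _ _ => 0) (fun _ _ => 0))) ∧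
      BetaUpperH β' γ₀ (betaOfRecord₁₃ F 2 (theta13OfThm1CCMWZB F 2 0 (1 / 2) ā 0 ε₂₉ 0 0 ā 0 (fun _ _ => 0) (fun _ _ => 0))))
    (hT : ∀ ε₂₉ : ℝ, 0 < ε₂₉ → ε₂₉ ≤ εmax → ∀ K (g : ℕ → ℝ) k, k < K → k + 1 + max c₀ c₁ ≤ F.m + K →
      {V : GaugeField (F.P K) (k + 1) (Node00.SU 2) | PlaqSmall δ₁₁ V} ⊆ regSetOfRecord F 2 K k
        (integrand (chiFixed29 F 2 (numerics7OfThm1CCM F.L 0 0 0 0 ā 0) ε₂₉ K g k) (gfOfRecord F 2 K k) (g k)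
          (effActionHT F 2 (TcanOfRecord F 2) (chiFixed29 F 2 (numerics7OfThm1CCM F.L 0 0 0 0 ā 0) ε₂₉) K g k))) :
    ∀ a : ℝ, 0 < a → ∃ a' : ℝ, 0 < a' ∧ a' ≤ a ∧
      ∃ (γ₀ ε₂₉ β' : ℝ) (j : ℕ) (ε₀ B₃'' B₃' a₁' : ℝ) (Efl logz : B12.RunParams → ℕ → ℝ), 0 < γ₀ ∧ 0 < ε₂₉ ∧
        BetaLowerH (-β') γ₀ (betaOfRecord₁₃ F 2 (theta13OfThm1CCMWZB F 2 j (1 / 2) a' ε₀ ε₂₉ B₃'' B₃' a' a₁' Efl logz)) ∧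
        BetaUpperH β' γ₀ (betaOfRecord₁₃ F 2 (theta13OfThm1CCMWZB F 2 j (1 / 2) a' ε₀ ε₂₉ B₃'' B₃' a' a₁' Efl logz)) := by
  have hB₃0 : 0 ≤ B₃ := by linarith
  exact k0BoxCofinalRadii_clause_of_boxAtFixedRadius_guarded F ā δ₁₁ a₀ (min a₁ (a₀ / B₃)) B₃ α tL rL BL εmax hā hāα₀ hB₃0 hBL hδ₁₁ hδα₁ hBδ hāα hα3 hα2 hα24 hαL
    hεmax hε53a hε53b hεδ hεα₁ hεB hεn1 hεn2 hεtL hεrL (fun K k => k + max c₀ c₁ ≤ F.m + K)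
    (fun K k (h : k + 1 + max c₀ c₁ ≤ F.m + K) => show k + max c₀ c₁ ≤ F.m + K by omega)
    (fun k => (eventually_ge_atTop (k + max c₀ c₁)).mono fun K hK => hK.trans (Nat.le_add_left K F.m))
    (hT1_guarded_of_texts F hB₃ h15 hEU) hUk h11 hLip hbox hT

/-! ## A6: the door-level letters of the texts editions are a jointly inhabited range -/

/-- **A6 — THE DOOR-LEVEL NUMERICS OF THE TEXTS EDITIONS ARE JOINTLY INHABITED.**  For every text ceiling `a₀, a₁ > 0`, constant `B₃ > 0` and `B_L ≥ 0`, `t_L, r_L > 0` there are a radius `ā`,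
a threshold `δ₁₁`, a Berge radius `α` and a threshold ceiling `εmax` satisfying ALL the door-level rows of `k0BoxCofinalRadii_clause_of_texts_of_boxAtFixedRadius` ∕
`…K0CompCofinalRadiiOfFixedRadiusGuarded.k0CompCofinalRadii_clause_of_texts_of_compAtFixedRadius` (`0 < ā < a₀`, `0 < δ₁₁ ≤ min a₁ (a₀∕B₃)`, `B₃δ₁₁ ≤ ā`, Berge's window at `α > ā`, the nine
`εmax`-rows with `B := B₃`): `α` from file 2's `openNumerics_inhabited`, `ā` below `α∕2`, `a₀∕2` and the two rider ceilings, `δ₁₁ := min (min a₁ (a₀∕B₃)) (ā∕B₃)`, `εmax` from file 4's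
`cofinalNumerics_inhabited` — so the doors' numeric side does not empty them (the [15]-side rows and NODE O's letter are the content). [cite: Balaban1985Averaging, Prop. 2 (52)–(53) p.26 (bookkeeping); Balaban1987RG1, p.267 (bookkeeping)] -/
theorem textsDoorNumerics_inhabited {B₃ a₀ a₁ BL tL rL : ℝ} (hB₃ : 0 < B₃) (ha₀ : 0 < a₀) (ha₁ : 0 < a₁) (hBL : 0 ≤ BL) (htL : 0 < tL) (hrL : 0 < rL) :
    ∃ ā δ₁₁ α εmax : ℝ, 0 < ā ∧ ā < a₀ ∧ 0 < δ₁₁ ∧ δ₁₁ ≤ min a₁ (a₀ / B₃) ∧ B₃ * δ₁₁ ≤ ā ∧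
      ā < α ∧ 143 * 256 * α ≤ 1 / 3 ∧ 2 * α ≤ 2 * deltaSU (Fin 2) / (8 * (F.L : ℝ)) ^ 2 ∧
      9 * (F.L : ℝ) ^ 2 * (2 * α) ≤ 1 / 24 ∧ 157 * (9 * (F.L : ℝ) ^ 2 * (2 * α)) < ((F.L : ℝ) ^ 3)⁻¹ ∧
      0 < εmax ∧
      143 * 256 * ((80 * BL * (F.L : ℝ) ^ 4 + 1) * εmax) ≤ 1 / 3 ∧
      2 * ((80 * BL * (F.L : ℝ) ^ 4 + 1) * εmax) ≤ 2 * deltaSU (Fin 2) / (8 * (F.L : ℝ)) ^ 2 ∧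
      2 * ((80 * BL * (F.L : ℝ) ^ 4 + 1) * εmax) ≤ δ₁₁ ∧ 2 * ((80 * BL * (F.L : ℝ) ^ 4 + 1) * εmax) ≤ min a₁ (a₀ / B₃) ∧
      2 * B₃ * ((80 * BL * (F.L : ℝ) ^ 4 + 1) * εmax) ≤ ā ∧
      1640 * (12 * (F.L : ℝ) * εmax + 18 * ā) * (F.L : ℝ) ^ 6 ≤ 1 ∧ 13 * (12 * (F.L : ℝ) * εmax + 18 * ā) * (F.L : ℝ) ^ 3 < deltaSU (Fin 2) ∧
      60 * (F.L : ℝ) ^ 4 * εmax ≤ tL ∧ (80 * BL * (F.L : ℝ) ^ 4 + 1) * εmax / (F.L : ℝ) ^ 2 ≤ rL := by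
  have hL1 : (1 : ℝ) ≤ (F.L : ℝ) := by exact_mod_cast F.hL.2.le
  have hL0 : (0 : ℝ) < (F.L : ℝ) := by linarith
  have hdS : 0 < deltaSU (Fin 2) := deltaSU_pos
  obtain ⟨α, hα, hα3, hα2, hα24, hαL⟩ := openNumerics_inhabited (F := F)
  -- the rider ceilings and the radius
  obtain ⟨r1, hr1⟩ : ∃ r : ℝ, r = 1 / (2 * (1640 * 18 * (F.L : ℝ) ^ 6)) := ⟨_, rfl⟩
  obtain ⟨r2, hr2⟩ : ∃ r : ℝ, r = deltaSU (Fin 2) / (2 * (13 * 18 * (F.L : ℝ) ^ 3)) := ⟨_, rfl⟩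
  have hr1pos : 0 < r1 := by rw [hr1]; positivity
  have hr2pos : 0 < r2 := by rw [hr2]; positivity
  obtain ⟨ā, hādef⟩ : ∃ ā : ℝ, ā = min (min (α / 2) (a₀ / 2)) (min r1 r2) := ⟨_, rfl⟩
  have hāpos : 0 < ā := by rw [hādef]; exact lt_min (lt_min (by positivity) (by positivity)) (lt_min hr1pos hr2pos)
  have hāα : ā < α := by
    have h : ā ≤ α / 2 := hādef ▸ (min_le_left _ _).trans (min_le_left _ _)
    linarith
  have hāa₀ : ā < a₀ := by
    have h : ā ≤ a₀ / 2 := hādef ▸ (min_le_left _ _).trans (min_le_right _ _)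
    linarith
  have hār1 : ā ≤ r1 := hādef ▸ (min_le_right _ _).trans (min_le_left _ _)
  have hār2 : ā ≤ r2 := hādef ▸ (min_le_right _ _).trans (min_le_right _ _)
  have hn1 : 1640 * (18 * ā) * (F.L : ℝ) ^ 6 < 1 := by
    have hpos : 0 < 1640 * 18 * (F.L : ℝ) ^ 6 := by positivity
    calc 1640 * (18 * ā) * (F.L : ℝ) ^ 6 = (1640 * 18 * (F.L : ℝ) ^ 6) * ā := by ring
      _ ≤ (1640 * 18 * (F.L : ℝ) ^ 6) * r1 := by gcongr
      _ = 1 / 2 := by rw [hr1]; field_simp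
      _ < 1 := by norm_num
  have hn2 : 13 * (18 * ā) * (F.L : ℝ) ^ 3 < deltaSU (Fin 2) := by
    have hpos : 0 < 13 * 18 * (F.L : ℝ) ^ 3 := by positivity
    calc 13 * (18 * ā) * (F.L : ℝ) ^ 3 = (13 * 18 * (F.L : ℝ) ^ 3) * ā := by ring
      _ ≤ (13 * 18 * (F.L : ℝ) ^ 3) * r2 := by gcongr
      _ = deltaSU (Fin 2) / 2 := by rw [hr2]; field_simp
      _ < deltaSU (Fin 2) := by linarith
  -- the threshold
  have hα₁' : 0 < min a₁ (a₀ / B₃) := lt_min ha₁ (div_pos ha₀ hB₃)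
  obtain ⟨δ₁₁, hδdef⟩ : ∃ δ : ℝ, δ = min (min a₁ (a₀ / B₃)) (ā / B₃) := ⟨_, rfl⟩
  have hδpos : 0 < δ₁₁ := by rw [hδdef]; exact lt_min hα₁' (div_pos hāpos hB₃)
  have hδα₁ : δ₁₁ ≤ min a₁ (a₀ / B₃) := hδdef ▸ min_le_left _ _
  have hBδ : B₃ * δ₁₁ ≤ ā := by
    have h : δ₁₁ ≤ ā / B₃ := hδdef ▸ min_le_right _ _
    calc B₃ * δ₁₁ ≤ B₃ * (ā / B₃) := mul_le_mul_of_nonneg_left h hB₃.le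
      _ = ā := mul_div_cancel₀ ā hB₃.ne'
  -- the threshold ceiling
  obtain ⟨εmax, hε, h1, h2, h3, h4, h5, h6, h7, h8, h9⟩ := cofinalNumerics_inhabited (F := F) (B := B₃) hāpos hδpos hα₁' hB₃.le hBL htL hrL hn1 hn2
  exact ⟨ā, δ₁₁, α, εmax, hāpos, hāa₀, hδpos, hδα₁, hBδ, hāα, hα3, hα2, hα24, hαL, hε, h1, h2, h3, h4, h5, h6, h7, h8, h9⟩

end Summit.QuantumFields.YangMills.BalabanUVNodes.K0BoxCofinalRadiiOfFixedRadiusGuarded
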